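import Mathlib
import Summits.ValiantsHypothesis.ValiantsHypothesis.Theorems.KPlusLogSqLawWeakLiftingTowerGraftSkewBlockIdentityGraftSharp
import Summits.ValiantsHypothesis.ValiantsHypothesis.Theorems.KPlusLogSqLawWeakLiftingTowerGraftFoldLawAxisPair
import Summits.ValiantsHypothesis.ValiantsHypothesis.Theorems.LacunarySymmetroidMatrixDescartesThreeLetters

/-!
# Tower graft line — ALL FOUR EVENT POLYNOMIALS OF THE AXIS-PAIR GRAFT ARE ROOTLESS ON THE SKEW-BLOCK FAMILY (the `J`-trick)

Calibration file for the line `Cruxes/WeakLifting/Lines/tower_graft.lean` (crux `WeakLifting` = stmt-ValiantsHypothesis-19561); companion of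
`…TowerGraftFoldLawAxisPair.lean` (p709692: (E0) `det G`, (Er) `ε = det((G.updateRow i eᵢ).updateRow j eⱼ)`, (Ed) the fold factors
`adj(U±ᵀ G U±)ⱼⱼ`, `U± = transvection j i (±1)`) and of `…SkewBlockAxisPairCrossings.lean`.  NO stub is claimed.

* `skewBlock_J_dot` — THE `J`-TRICK: for `M = [[c·1, B],[Bᵀ, −c·1]]` and `J = diag(1_p, −1_{q+1})`, `(Jw)·(Mw) = c·|w|²`;
  ★ `det_compression_skewBlock_ne_zero` — hence EVERY compression `PᵀMP` with `P` injective and `J`-invariant range (`JP = PQ`) is non-singular.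
* bookkeeping: `det_updateRow_single_eq_submatrix` (one unit row = principal minor), `transpose_incl_mul_mul_incl`, `mulVec_incl_injective`,
  `fromBlocks_one_neg_one_eq_diagonal`, `diagonal_mul_submatrix_one`, `mul_diagonal_submatrix`, `mul_submatrix_id`,
  `mulVec_submatrix_injective_of_det_ne_zero`, `diagonal_mul_transvection_inr` (a transvection inside the negative block commutes with `J`),
  `map_C_map_evalRingHom`, private `transvection_map_C_sum`; reused: `GramDual.gram_submatrix` (`…ThreeLetters`).
* ★ `card_posRoots_pairMinor_skewBlock_eq_zero` — (Er) EMPTY: `ε` (rows `inr i`, `inr j` replaced by unit rows) has no positive root, every `η ≠ 0`;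
  ★ `card_posRoots_foldFactor_skewBlock_eq_zero` — (Ed) EMPTY: `adj(Uᵀ G_η U)_{inr j, inr j}`, `U = transvection (inr j) (inr i) c`, has no positive
  root, every `η ≠ 0`, every real `c` (so both fold factors, `c = ±1`).  ((E0) EMPTY is p688917 `card_posRoots_det_skewBlock_pencil_eq_zero`.)

HONEST FRAMING: linear algebra; nothing on S4/S4b/S5/S5ᴸ, TowerB, `WeakLifting`, Conjecture B, `MatrixDescartes` (18050) or `VP ≠ VNP`.  Def-free.
Seat: prover val-sym-lift-p2 g21, `--supports stmt-ValiantsHypothesis-19561`.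
-/

-- `Summit.ValiantsHypothesis.ValiantsHypothesis.…` repeats a component by the D-0017 layout
-- (single-conjunct summit), which the `dupNamespace` linter flags; the name is mandated.
set_option linter.dupNamespace false

namespace Summit.ValiantsHypothesis.ValiantsHypothesis.Theorems.KPlusLogSqLaw.TowerGraft

open Polynomial Matrix
open scoped BigOperators Polynomial

section AxisPairEvents

variable {p q : ℕ}

/-- **THE `J`-TRICK**: for the skew block `M = [[c·1, B],[Bᵀ, −c·1]]` and `J = [[1,0],[0,−1]]`, `(Jw)·(Mw) = c·|w|²`. [this work] -/
theorem skewBlock_J_dot (c : ℝ) (B : Matrix (Fin p) (Fin (q + 1)) ℝ) (w : Fin p ⊕ Fin (q + 1) → ℝ) :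
    (Matrix.fromBlocks (1 : Matrix (Fin p) (Fin p) ℝ) 0 0 (-(1 : Matrix (Fin (q + 1)) (Fin (q + 1)) ℝ)) *ᵥ w) ⬝ᵥ
        (Matrix.fromBlocks (c • (1 : Matrix (Fin p) (Fin p) ℝ)) B Bᵀ (-(c • (1 : Matrix (Fin (q + 1)) (Fin (q + 1)) ℝ))) *ᵥ w) =
      c * (w ⬝ᵥ w) := by
  have hw : w = Sum.elim (w ∘ Sum.inl) (w ∘ Sum.inr) := (Sum.elim_comp_inl_inr w).symm
  rw [Matrix.fromBlocks_mulVec, Matrix.fromBlocks_mulVec]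
  conv_rhs => rw [hw]
  rw [sumElim_dotProduct_sumElim, sumElim_dotProduct_sumElim]
  simp only [Matrix.one_mulVec, Matrix.zero_mulVec, add_zero, zero_add, Matrix.neg_mulVec, Matrix.smul_mulVec, neg_dotProduct,
    dotProduct_add, dotProduct_neg, dotProduct_smul, smul_eq_mul]
  have hsym : (w ∘ Sum.inr) ⬝ᵥ (Bᵀ *ᵥ (w ∘ Sum.inl)) = (w ∘ Sum.inl) ⬝ᵥ (B *ᵥ (w ∘ Sum.inr)) := by
    rw [dotProduct_mulVec, vecMul_transpose, dotProduct_comm]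
  rw [hsym]
  ring

/-- **PRINCIPAL SUB-COMPRESSIONS OF A SKEW BLOCK ARE NON-SINGULAR**: if `P` has injective `mulVec` and a `J`-invariant range (`J P = P Q`),
then `Pᵀ M P` is non-singular (`c ≠ 0`).  [this work] -/
theorem det_compression_skewBlock_ne_zero {ι : Type*} [Fintype ι] [DecidableEq ι] (c : ℝ) (hc : c ≠ 0) (B : Matrix (Fin p) (Fin (q + 1)) ℝ)
    (P : Matrix (Fin p ⊕ Fin (q + 1)) ι ℝ) (Q : Matrix ι ι ℝ)
    (hJ : Matrix.fromBlocks (1 : Matrix (Fin p) (Fin p) ℝ) 0 0 (-(1 : Matrix (Fin (q + 1)) (Fin (q + 1)) ℝ)) * P = P * Q)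
    (hP : Function.Injective P.mulVec) :
    (Pᵀ * Matrix.fromBlocks (c • (1 : Matrix (Fin p) (Fin p) ℝ)) B Bᵀ (-(c • (1 : Matrix (Fin (q + 1)) (Fin (q + 1)) ℝ))) * P).det ≠ 0 := by
  set M := Matrix.fromBlocks (c • (1 : Matrix (Fin p) (Fin p) ℝ)) B Bᵀ (-(c • (1 : Matrix (Fin (q + 1)) (Fin (q + 1)) ℝ))) with hM
  set J := Matrix.fromBlocks (1 : Matrix (Fin p) (Fin p) ℝ) 0 0 (-(1 : Matrix (Fin (q + 1)) (Fin (q + 1)) ℝ)) with hJdef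
  -- injectivity of `Pᵀ M P`
  suffices hinj : Function.Injective (Pᵀ * M * P).mulVec by
    intro h0
    obtain ⟨v, hv0, hv⟩ := Matrix.exists_mulVec_eq_zero_iff.mpr h0
    exact hv0 (hinj (by rw [hv, Matrix.mulVec_zero]))
  intro x y hxy
  rw [← sub_eq_zero]
  set z := x - y with hz
  have h0 : (Pᵀ * M * P) *ᵥ z = 0 := by rw [hz, Matrix.mulVec_sub, hxy, sub_self]
  -- pair with `Q z`: `(Q z)·(Pᵀ M P z) = (P Q z)·(M P z) = (J P z)·(M P z) = c |P z|²`
  have h1 : (Q *ᵥ z) ⬝ᵥ ((Pᵀ * M * P) *ᵥ z) = c * ((P *ᵥ z) ⬝ᵥ (P *ᵥ z)) := by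
    rw [← Matrix.mulVec_mulVec, ← Matrix.mulVec_mulVec, dotProduct_mulVec, vecMul_transpose, Matrix.mulVec_mulVec, ← hJ,
      ← Matrix.mulVec_mulVec, hJdef, hM, skewBlock_J_dot]
  rw [h0, dotProduct_zero] at h1
  have h2 : (P *ᵥ z) ⬝ᵥ (P *ᵥ z) = 0 := by
    rcases mul_eq_zero.mp h1.symm with h | h
    · exact absurd h hc
    · exact h
  have h3 : P *ᵥ z = 0 := dotProduct_self_eq_zero.mp h2
  exact hP (by rw [h3, Matrix.mulVec_zero])

/-- replacing row `j` by the unit row `eⱼ` leaves the principal minor off `j`. [folklore] -/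
theorem det_updateRow_single_eq_submatrix {n : Type*} [Fintype n] [DecidableEq n] {R : Type*} [CommRing R] (G : Matrix n n R) (j : n) :
    (G.updateRow j (Pi.single j (1 : R))).det = (G.submatrix (Subtype.val : {a // a ≠ j} → n) Subtype.val).det := by
  set M := G.updateRow j (Pi.single j (1 : R)) with hM
  have hMj : M j = Pi.single j 1 := by rw [hM, Matrix.updateRow_self]
  have hMr : ∀ r, r ≠ j → M r = G r := fun r hrj => by rw [hM, Matrix.updateRow_ne hrj]
  rw [Matrix.twoBlockTriangular_det M (fun a => a ≠ j)]
  · have h1 : M.toSquareBlockProp (fun a => a ≠ j) = G.submatrix (Subtype.val : {a // a ≠ j} → n) Subtype.val := by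
      ext ⟨a, ha⟩ ⟨b, hb⟩
      simp [Matrix.toSquareBlockProp_def, hMr a ha]
    have h2 : M.toSquareBlockProp (fun a => ¬(a ≠ j)) = 1 := by
      ext ⟨a, ha⟩ ⟨b, hb⟩
      simp only [Matrix.toSquareBlockProp_def, Matrix.of_apply, Matrix.one_apply, Subtype.mk.injEq]
      have ha' : a = j := by simpa using ha
      have hb' : b = j := by simpa using hb
      subst ha'; rw [hMj, Pi.single_apply]; simp [eq_comm]
    rw [h1, h2, Matrix.det_one, mul_one]
  · intro r hr a ha
    have hr' : r = j := by simpa using hr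
    subst hr'
    rw [hMj, Pi.single_apply, if_neg ha]

/-- the coordinate inclusion of a subtype as a matrix, and its compression = the principal submatrix. [folklore] -/
theorem transpose_incl_mul_mul_incl {n : Type*} [Fintype n] [DecidableEq n] {R : Type*} [CommRing R] (M : Matrix n n R) (pr : n → Prop)
    [DecidablePred pr] :
    ((1 : Matrix n n R).submatrix id (Subtype.val : {a // pr a} → n))ᵀ * M *
        (1 : Matrix n n R).submatrix id (Subtype.val : {a // pr a} → n) =
      M.submatrix (Subtype.val : {a // pr a} → n) (Subtype.val : {a // pr a} → n) := by
  ext ⟨a, ha⟩ ⟨b, hb⟩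
  simp [Matrix.mul_apply, Matrix.one_apply, Matrix.submatrix_apply]

/-- the coordinate inclusion has injective `mulVec` (extension by zero). [folklore] -/
theorem mulVec_incl_injective {n : Type*} [Fintype n] [DecidableEq n] {R : Type*} [CommRing R] (pr : n → Prop) [DecidablePred pr] :
    Function.Injective ((1 : Matrix n n R).submatrix id (Subtype.val : {a // pr a} → n)).mulVec := by
  intro x y hxy
  funext ⟨b, hb⟩
  have h := congrFun hxy b
  simp only [Matrix.mulVec, dotProduct, Matrix.submatrix_apply, id, Matrix.one_apply] at h
  rw [Finset.sum_eq_single ⟨b, hb⟩, Finset.sum_eq_single ⟨b, hb⟩] at h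
  · simpa using h
  all_goals first
    | (intro c _ hc; have : (b : n) ≠ c.val := fun e => hc (Subtype.ext e.symm); simp [this])
    | (intro h'; exact absurd (Finset.mem_univ _) h')

/-- the diagonal form of `J`. [folklore] -/
theorem fromBlocks_one_neg_one_eq_diagonal :
    Matrix.fromBlocks (1 : Matrix (Fin p) (Fin p) ℝ) 0 0 (-(1 : Matrix (Fin (q + 1)) (Fin (q + 1)) ℝ)) =
      Matrix.diagonal (Sum.elim (fun _ => (1 : ℝ)) (fun _ => (-1 : ℝ))) := by
  ext (a | a) (b | b) <;> simp [Matrix.fromBlocks, Matrix.one_apply, Matrix.diagonal]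
  split_ifs <;> simp_all

/-- a diagonal matrix passes through a column selection. [folklore] -/
theorem diagonal_mul_submatrix_one {n ι : Type*} [Fintype n] [DecidableEq n] [Fintype ι] [DecidableEq ι] {R : Type*} [CommRing R]
    (w : n → R) (f : ι → n) :
    Matrix.diagonal w * (1 : Matrix n n R).submatrix id f = (1 : Matrix n n R).submatrix id f * Matrix.diagonal (w ∘ f) := by
  ext a b
  rw [Matrix.diagonal_mul, Matrix.mul_diagonal]
  simp only [Matrix.submatrix_apply, id, Matrix.one_apply, Function.comp]
  by_cases h : a = f b
  · subst h; simp
  · simp [h]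

/-- column selection after right multiplication by a diagonal matrix. [folklore] -/
theorem mul_diagonal_submatrix {m n ι : Type*} [Fintype n] [DecidableEq n] [Fintype ι] [DecidableEq ι] {R : Type*} [CommRing R]
    (A : Matrix m n R) (w : n → R) (f : ι → n) :
    (A * Matrix.diagonal w).submatrix id f = A.submatrix id f * Matrix.diagonal (w ∘ f) := by
  ext a b
  simp [Matrix.mul_apply, Matrix.diagonal, Matrix.submatrix_apply, Function.comp]

/-- column selection after left multiplication. [folklore] -/
theorem mul_submatrix_id {n ι : Type*} [Fintype n] [DecidableEq n] {R : Type*} [CommRing R] (A B : Matrix n n R) (f : ι → n) :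
    (A * B).submatrix id f = A * B.submatrix id f := by
  ext a b
  simp [Matrix.mul_apply, Matrix.submatrix_apply]

/-- a column selection of an invertible matrix has injective `mulVec`. [folklore] -/
theorem mulVec_submatrix_injective_of_det_ne_zero {n ι : Type*} [Fintype n] [DecidableEq n] [Fintype ι] [DecidableEq ι]
    (U : Matrix n n ℝ) (hU : U.det ≠ 0) (f : ι → n) (hf : Function.Injective f) :
    Function.Injective (U.submatrix id f).mulVec := by
  have e : U.submatrix id f = U * (1 : Matrix n n ℝ).submatrix id f := by rw [← mul_submatrix_id, Matrix.mul_one]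
  rw [e]
  intro x y hxy
  rw [← Matrix.mulVec_mulVec, ← Matrix.mulVec_mulVec] at hxy
  have h1 := (Matrix.mulVec_injective_iff_isUnit.mpr ((Matrix.isUnit_iff_isUnit_det _).mpr (isUnit_iff_ne_zero.mpr hU))) hxy
  -- the coordinate selection is injective (extension by zero)
  have key : ∀ z : ι → ℝ, ∀ b, ((1 : Matrix n n ℝ).submatrix id f *ᵥ z) (f b) = z b := by
    intro z b
    simp only [Matrix.mulVec, dotProduct, Matrix.submatrix_apply, id, Matrix.one_apply]
    rw [Finset.sum_eq_single b]
    · simp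
    · intro c _ hc
      have hne : f b ≠ f c := fun h => hc (hf h).symm
      simp [hne]
    · intro h; exact absurd (Finset.mem_univ b) h
  funext b
  rw [← key x b, ← key y b, h1]

/-- `J` commutes with a transvection inside the negative block. [folklore] -/
theorem diagonal_mul_transvection_inr (i j : Fin (q + 1)) (c : ℝ) :
    Matrix.diagonal (Sum.elim (fun _ : Fin p => (1 : ℝ)) (fun _ : Fin (q + 1) => (-1 : ℝ))) *
        Matrix.transvection (Sum.inr j : Fin p ⊕ Fin (q + 1)) (Sum.inr i) c =
      Matrix.transvection (Sum.inr j : Fin p ⊕ Fin (q + 1)) (Sum.inr i) c *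
        Matrix.diagonal (Sum.elim (fun _ : Fin p => (1 : ℝ)) (fun _ : Fin (q + 1) => (-1 : ℝ))) := by
  ext a b
  simp only [Matrix.transvection, Matrix.add_apply, Matrix.diagonal_mul, Matrix.mul_diagonal, Matrix.single_apply]
  rcases a with a | a <;> rcases b with b | b <;> simp

/-- the real transvection mapped into `ℝ[X]` — a `private` copy of the tree's `WordPerSuperQuartic.transvection_map` (×3 in
`…ElementaryWordLength…` modules, which the farm does not serve as imports here), kept local per R2964's private-copy clause. [folklore] -/
private theorem transvection_map_C_sum {n : Type*} [DecidableEq n] (j i : n) (r : ℝ) :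
    (Matrix.transvection j i r).map (C : ℝ →+* ℝ[X]) = Matrix.transvection j i (C r) := by
  ext a b
  simp only [Matrix.transvection, Matrix.map_apply, Matrix.add_apply, Matrix.one_apply, Matrix.single_apply, map_add]
  split_ifs <;> simp

/-- evaluation undoes `map C`. [folklore] -/
theorem map_C_map_evalRingHom {m n : Type*} (U : Matrix m n ℝ) (t : ℝ) :
    (U.map (C : ℝ →+* ℝ[X])).map (Polynomial.evalRingHom t) = U := by
  ext a b
  simp

/-- **(Er) IS EMPTY for the skew-block axis-pair graft**: the principal minor off `{inr i, inr j}` of the skew-block pencil (in the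
`updateRow` form of `…FoldLawAxisPair`) has no positive root, for every `η ≠ 0`. [this work] -/
theorem card_posRoots_pairMinor_skewBlock_eq_zero {K : ℕ} (d : Fin K → ℕ) (l₀ : Fin K) {η : ℝ} (hη : η ≠ 0)
    (B : Fin K → Matrix (Fin p) (Fin (q + 1)) ℝ) {i j : Fin (q + 1)} (hij : i ≠ j) :
 ((((∑ l, (X : ℝ[X]) ^ d l • (Matrix.fromBlocks (if l = l₀ then η • (1 : Matrix (Fin p) (Fin p) ℝ) else 0) (B l) (B l)ᵀ
        (if l = l₀ then -(η • (1 : Matrix (Fin (q + 1)) (Fin (q + 1)) ℝ)) else 0)).map C).updateRow (Sum.inr i)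
        (Pi.single (Sum.inr i) 1)).updateRow (Sum.inr j) (Pi.single (Sum.inr j) 1)).det.roots.toFinset.filter
        (fun t => 0 < t)).card = 0 := by
  classical
  have hij' : (Sum.inr i : Fin p ⊕ Fin (q + 1)) ≠ Sum.inr j := fun h => hij (Sum.inr_injective h)
  refine card_posRoots_eq_zero_of_eval_ne_zero _ fun t ht => ?_
  set Gp := ∑ l, (X : ℝ[X]) ^ d l • (Matrix.fromBlocks (if l = l₀ then η • (1 : Matrix (Fin p) (Fin p) ℝ) else 0) (B l) (B l)ᵀ
        (if l = l₀ then -(η • (1 : Matrix (Fin (q + 1)) (Fin (q + 1)) ℝ)) else 0)).map C with hGp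
  set M := Matrix.fromBlocks ((η * t ^ d l₀) • (1 : Matrix (Fin p) (Fin p) ℝ)) (∑ l, t ^ d l • B l) (∑ l, t ^ d l • B l)ᵀ
        (-((η * t ^ d l₀) • (1 : Matrix (Fin (q + 1)) (Fin (q + 1)) ℝ))) with hM
  have hGt : Gp.map (eval t) = M := by rw [hGp, lacunaryPencil_map_eval, skewBlock_pencil_eval]
  have hev : (((Gp.updateRow (Sum.inr i) (Pi.single (Sum.inr i) 1)).updateRow (Sum.inr j) (Pi.single (Sum.inr j) 1)).det).eval t =
      ((M.updateRow (Sum.inr i) (Pi.single (Sum.inr i) 1)).updateRow (Sum.inr j) (Pi.single (Sum.inr j) 1)).det := by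
    rw [← Polynomial.coe_evalRingHom, RingHom.map_det, RingHom.mapMatrix_apply, ← hGt]
    congr 1
    ext a b
    simp only [Matrix.map_apply, Matrix.updateRow_apply, Pi.single_apply, Polynomial.coe_evalRingHom]
    split_ifs <;> simp
  rw [hev, det_updateRow_single_updateRow_single _ hij', ← transpose_incl_mul_mul_incl, hM]
  have hc : η * t ^ d l₀ ≠ 0 := mul_ne_zero hη (pow_ne_zero _ ht.ne')
  refine det_compression_skewBlock_ne_zero (η * t ^ d l₀) hc _ _
    (Matrix.diagonal ((Sum.elim (fun _ : Fin p => (1 : ℝ)) (fun _ : Fin (q + 1) => (-1 : ℝ))) ∘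
      (Subtype.val : {a : Fin p ⊕ Fin (q + 1) // a ≠ Sum.inr i ∧ a ≠ Sum.inr j} → _))) ?_ (mulVec_incl_injective _)
  rw [fromBlocks_one_neg_one_eq_diagonal, diagonal_mul_submatrix_one]

/-- **(Ed) IS EMPTY for the skew-block axis-pair graft**: each fold factor `adj(Uᵀ G_η U)_{inr j, inr j}`, `U = transvection (inr j) (inr i) c`
(cf. `foldFactor_sub_eq` / `foldFactor_add_eq` with `c = ±1`), has no positive root, for every `η ≠ 0` and every real `c`. [this work] -/
theorem card_posRoots_foldFactor_skewBlock_eq_zero {K : ℕ} (d : Fin K → ℕ) (l₀ : Fin K) {η : ℝ} (hη : η ≠ 0)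
    (B : Fin K → Matrix (Fin p) (Fin (q + 1)) ℝ) {i j : Fin (q + 1)} (hij : i ≠ j) (c : ℝ) :
    ((((Matrix.transvection (Sum.inr j : Fin p ⊕ Fin (q + 1)) (Sum.inr i) (C c))ᵀ *
        (∑ l, (X : ℝ[X]) ^ d l • (Matrix.fromBlocks (if l = l₀ then η • (1 : Matrix (Fin p) (Fin p) ℝ) else 0) (B l) (B l)ᵀ
          (if l = l₀ then -(η • (1 : Matrix (Fin (q + 1)) (Fin (q + 1)) ℝ)) else 0)).map C) *
        Matrix.transvection (Sum.inr j : Fin p ⊕ Fin (q + 1)) (Sum.inr i) (C c)).adjugate (Sum.inr j) (Sum.inr j)).roots.toFinset.filter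
        (fun t => 0 < t)).card = 0 := by
  classical
  have hji' : (Sum.inr j : Fin p ⊕ Fin (q + 1)) ≠ Sum.inr i := fun h => hij (Sum.inr_injective h).symm
  refine card_posRoots_eq_zero_of_eval_ne_zero _ fun t ht => ?_
  set U : Matrix (Fin p ⊕ Fin (q + 1)) (Fin p ⊕ Fin (q + 1)) ℝ := Matrix.transvection (Sum.inr j) (Sum.inr i) c with hU
  set Gp := ∑ l, (X : ℝ[X]) ^ d l • (Matrix.fromBlocks (if l = l₀ then η • (1 : Matrix (Fin p) (Fin p) ℝ) else 0) (B l) (B l)ᵀ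
        (if l = l₀ then -(η • (1 : Matrix (Fin (q + 1)) (Fin (q + 1)) ℝ)) else 0)).map C with hGp
  set M := Matrix.fromBlocks ((η * t ^ d l₀) • (1 : Matrix (Fin p) (Fin p) ℝ)) (∑ l, t ^ d l • B l) (∑ l, t ^ d l • B l)ᵀ
        (-((η * t ^ d l₀) • (1 : Matrix (Fin (q + 1)) (Fin (q + 1)) ℝ))) with hM
  have hGt : Gp.map (eval t) = M := by rw [hGp, lacunaryPencil_map_eval, skewBlock_pencil_eval]
  have hev : (((Matrix.transvection (Sum.inr j : Fin p ⊕ Fin (q + 1)) (Sum.inr i) (C c))ᵀ * Gp *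
        Matrix.transvection (Sum.inr j : Fin p ⊕ Fin (q + 1)) (Sum.inr i) (C c)).adjugate (Sum.inr j) (Sum.inr j)).eval t =
      (Uᵀ * M * U).adjugate (Sum.inr j) (Sum.inr j) := by
    have hGt' : Gp.map (Polynomial.evalRingHom t) = M := by rw [← hGt]; rfl
    have hmat : ((Matrix.transvection (Sum.inr j : Fin p ⊕ Fin (q + 1)) (Sum.inr i) (C c))ᵀ * Gp *
        Matrix.transvection (Sum.inr j : Fin p ⊕ Fin (q + 1)) (Sum.inr i) (C c)).map (Polynomial.evalRingHom t) = Uᵀ * M * U := by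
      rw [Matrix.map_mul, Matrix.map_mul, Matrix.transpose_map,
        ← transvection_map_C_sum, map_C_map_evalRingHom, hGt', hU]
    have h := RingHom.map_adjugate (Polynomial.evalRingHom t)
      ((Matrix.transvection (Sum.inr j : Fin p ⊕ Fin (q + 1)) (Sum.inr i) (C c))ᵀ * Gp *
        Matrix.transvection (Sum.inr j : Fin p ⊕ Fin (q + 1)) (Sum.inr i) (C c))
    have h' := congrFun (congrFun h (Sum.inr j)) (Sum.inr j)
    rw [RingHom.mapMatrix_apply, Matrix.map_apply, RingHom.mapMatrix_apply, hmat, Polynomial.coe_evalRingHom] at h'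
    exact h'
  rw [hev, Matrix.adjugate_apply, det_updateRow_single_eq_submatrix,
    Summit.ValiantsHypothesis.ValiantsHypothesis.Theorems.LacunarySymmetroidMatrixDescartes.GramDual.gram_submatrix, hM]
  have hc : η * t ^ d l₀ ≠ 0 := mul_ne_zero hη (pow_ne_zero _ ht.ne')
  refine det_compression_skewBlock_ne_zero (η * t ^ d l₀) hc _ _
    (Matrix.diagonal ((Sum.elim (fun _ : Fin p => (1 : ℝ)) (fun _ : Fin (q + 1) => (-1 : ℝ))) ∘
      (Subtype.val : {a : Fin p ⊕ Fin (q + 1) // a ≠ Sum.inr j} → _))) ?_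
    (mulVec_submatrix_injective_of_det_ne_zero U (by rw [hU, Matrix.det_transvection_of_ne _ _ hji']; exact one_ne_zero) _
      Subtype.val_injective)
  rw [fromBlocks_one_neg_one_eq_diagonal, ← mul_submatrix_id, hU, diagonal_mul_transvection_inr, mul_diagonal_submatrix]

end AxisPairEvents

end Summit.ValiantsHypothesis.ValiantsHypothesis.Theorems.KPlusLogSqLaw.TowerGraft
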